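import Literature.NumberTheory.Sieve.QuadraticRootsAllModuliVectors
import Mathlib.Algebra.QuadraticDiscriminant
import HarnessLib

/-!
# Iwaniec (1978) for a general quadratic: the roots of `G(Θ) ≡ 0 (mod D)` and the admissible representations of `aD` by the classes of forms of discriminant `Δ` — PROVED

H. Iwaniec, *Almost-primes represented by quadratic polynomials*, Invent. Math. **47** (1978)
171–188, Lemma 5 (p. 178) parametrises the roots of `Ω² + 1 ≡ 0 (mod D)` by the primitive
representations `D = r² + s²` ("This result, due of course to Lagrange is to be found in Article
86 of [Smith's Report]"), and the paper adds that the case of a general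
`G = aX² + bX + c` "is similar" (p. 172).  This file proves the general statement behind that
remark — the classical correspondence of Gauss between the solutions `ℓ (mod 2n)` of
`ℓ² ≡ Δ (mod 4n)` and the proper representations of `n` by the classes of forms of
discriminant `Δ` — in the shape needed for `G` and for Iwaniec's dispersion argument, where the
roots carry congruence side conditions.  It is built on the tree's `RootForms` trunk
(`QuadraticRootsLevelForms/Classes/Cosets.lean`, `QuadraticRootsAllModuliVectors.lean`:
the action `smul`, `vecAct`, the stabilisers `stab`, the finite set `RootForms.classReps Δ`
meeting every class, the free action `eq_one_of_vecAct_eq`), and adds what the Iwaniec files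
need on top of it:

Let `Δ = b² − 4ac` be a non-square, `a > 0`, `D ≥ 1`, `n = aD`.
* `posReps Δ` — ONE representative with POSITIVE leading coefficient in every class containing
  such a form (`existsUnique_mem_posReps_properEquiv`; chosen by `Classical.epsilon` class by
  class inside `RootForms.classReps Δ`; for `Δ < 0` these are the positive definite classes,
  for `Δ > 0` all classes);
* `thetaForm a b c D Θ = (aD, 2aΘ + b, G(Θ)/D)` — the form attached to a root `Θ` of `G` mod `D`
  (`= RootForms.rootForm a b c D (2aΘ + b)`, indexed by the root rather than by the residue);
* `ellOf Φ u s` — the middle coefficient of `Φ·γ_v` for the Bezout completion `γ_v = complSL v`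
  of a coprime `v = (u, s)`, `thetaOf a b Φ v = (ℓ − b)/(2a)`, and the *admissible
  representations* `IsAdmRep a b Φ n v` (`v` coprime, `Φ(v) = n`, `ℓ ≡ b (mod 2a)`);
* `act_b_modEq_of_modEq` — the TRANSPORT LEMMA: `ℓ` modulo `M` depends only on `v` modulo `M`
  whenever `M ∣ 2Φ(v)`; with `M = 2ad`, `d ∣ D`, this makes "`Θ ≡ ω (mod d)`" a congruence
  condition on `(u, s) mod 2ad` (no coprimality of `s` with `a` or `D` is needed — the point
  where the non-monic case differs from Lemke Oliver's treatment, Acta Arith. 151 (2012) §3);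
* `dvd_quad_thetaOf`, `smul_complSL_eq_thetaForm` — an admissible representation of `aD` gives
  a root `Θ_Φ(v)` of `G` mod `D`, with `Φ·γ_v = Ψ_{Θ_Φ(v)}` exactly;
* `exists_isAdmRep_of_dvd`, `eq_of_thetaOf_modEq` — every root arises, from exactly one
  `Φ ∈ posReps Δ`;
* `exists_mem_stab_of_thetaOf_modEq`, `isAdmRep_vecAct` — the fibres of `v ↦ Θ_Φ(v) mod D` are
  the `stab Φ`-orbits.

So the roots of `G` mod `D` are in canonical bijection with `⊔_{Φ ∈ posReps Δ} AdmRep(Φ, aD)/stab Φ`;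
the counting through fundamental domains and the phase formula follow in the next files.
Everything here is PROVED; no named facts are introduced.

## References

* H. Iwaniec, Invent. Math. 47 (1978) 171–188, §4, Lemma 5 and p. 172 (`IwaniecInventiones1978`).
* D. A. Cox, *Primes of the form x² + ny²*, 2nd ed. (2013), §2.A, Lemma 2.3, Lemma 2.5 and
  Exercise 2.11 (`Cox2013`).
* W. Duke, J. B. Friedlander, H. Iwaniec, Ann. of Math. 141 (1995), §2 (the `RootForms` trunk)
  (`DukeFriedlanderIwaniec1995`).
* R. J. Lemke Oliver, Acta Arith. 151 (2012) 241–261, §3 (`LemkeOliverActaArith2012`).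
-/

noncomputable section

namespace Literature.NumberTheory.Sieve.Iwaniec1978

open Literature.NumberTheory.QuadraticFields.Quadratic
open Literature.NumberTheory.QuadraticFields.Quadratic.BinQF
open Literature.NumberTheory.Sieve.RootForms (smul smul_one smul_mul smul_mul_inv smul_inv_mul
  smul_a smul_disc smul_T_zpow vecAct vecAct_mul vecAct_one vecAct_e1 vecAct_neg eval_vecAct
  stab mem_stab_iff neg_one_mem_stab eval_vecAct_of_mem_stab not_isSquare_smul_disc)
open scoped MatrixGroups

/-! ### `SL₂(ℤ)` on forms and vectors: complements to the `RootForms` trunk -/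

/-- Properly equivalent forms have the same discriminant. [cite: Cox2013, §2.A] -/
theorem properEquiv_disc_eq {f g : BinQF} (h : f.ProperEquiv g) : g.disc = f.disc := by
  obtain ⟨p, q, r, s, hdet, rfl⟩ := h
  rw [disc_act, hdet, one_pow, one_mul]

/-- A form of non-square discriminant takes the value `0` only at `(0, 0)`
(`4a f(x,y) = (2ax + by)² − Δ y²`, `a ≠ 0`). [folklore] -/
theorem eval_ne_zero_of_not_isSquare {f : BinQF} (h : ¬ IsSquare f.disc) {x y : ℤ}
    (hxy : x ≠ 0 ∨ y ≠ 0) : f.eval x y ≠ 0 := by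
  intro h0
  have ha := RootForms.a_ne_zero_of_not_isSquare h
  have key : (2 * f.a * x + f.b * y) ^ 2 = f.disc * y ^ 2 := by
    have := f.four_mul_a_mul_eval x y
    rw [h0, mul_zero] at this
    linear_combination -this
  by_cases hy : y = 0
  · have hx : x ≠ 0 := hxy.resolve_right (fun h' => h' hy)
    rw [hy] at key
    simp only [mul_zero, add_zero, ne_eq, OfNat.ofNat_ne_zero, not_false_eq_true, zero_pow] at key
    have : 2 * f.a * x = 0 := pow_eq_zero_iff (n := 2) (by norm_num) |>.mp key
    rcases mul_eq_zero.mp this with h2a | hx0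
    · exact ha (by simpa using h2a)
    · exact hx hx0
  · apply h
    have hdvd : y ^ 2 ∣ (2 * f.a * x + f.b * y) ^ 2 := ⟨f.disc, by rw [key]; ring⟩
    obtain ⟨t, ht⟩ := (Int.pow_dvd_pow_iff two_ne_zero).mp hdvd
    refine ⟨t, ?_⟩
    have hy2 : y ^ 2 ≠ 0 := pow_ne_zero 2 hy
    have : f.disc * y ^ 2 = (t * t) * y ^ 2 := by rw [← key, ht]; ring
    exact mul_right_cancel₀ hy2 this

/-- The determinant of `γ ∈ SL₂(ℤ)` written out. [folklore] -/
theorem det_SL_two (γ : SL(2, ℤ)) : γ 0 0 * γ 1 1 - γ 0 1 * γ 1 0 = 1 := by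
  have h := γ.2
  rw [Matrix.det_fin_two] at h
  exact h

/-- Proper equivalence in terms of `SL₂(ℤ)`: `f ~ g ↔ g = f·γ` for some `γ`. [cite: Cox2013, §2.A] -/
theorem properEquiv_iff_exists_smul {f g : BinQF} :
    f.ProperEquiv g ↔ ∃ γ : SL(2, ℤ), g = smul f γ := by
  constructor
  · rintro ⟨p, q, r, s, hdet, rfl⟩
    refine ⟨⟨!![p, q; r, s], by rw [Matrix.det_fin_two_of]; exact hdet⟩, ?_⟩
    simp [smul]
  · rintro ⟨γ, rfl⟩
    exact ⟨γ 0 0, γ 0 1, γ 1 0, γ 1 1, det_SL_two γ, rfl⟩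

/-- The columns of `γ ∈ SL₂(ℤ)` are coprime vectors: `γ·v` is coprime if `v` is. [folklore] -/
theorem isCoprime_vecAct (γ : SL(2, ℤ)) {v : ℤ × ℤ} (hv : IsCoprime v.1 v.2) :
    IsCoprime (vecAct γ v).1 (vecAct γ v).2 := by
  obtain ⟨x, y, hxy⟩ := hv
  have hdet := det_SL_two γ
  refine ⟨x * γ 1 1 - y * γ 1 0, -(x * γ 0 1) + y * γ 0 0, ?_⟩
  simp only [vecAct]
  linear_combination (x * v.1 + y * v.2) * hdet + hxy

/-- The first column of `γ ∈ SL₂(ℤ)` is a coprime vector. [folklore] -/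
theorem isCoprime_col (γ : SL(2, ℤ)) : IsCoprime (γ 0 0) (γ 1 0) :=
  ⟨γ 1 1, -(γ 0 1), by linear_combination det_SL_two γ⟩

/-- `stab Φ` acts freely on coprime vectors (the tree's `RootForms.eq_one_of_vecAct_eq`, stated
with `IsCoprime`). [cite: Cox2013, §2.A (Exercise 2.11)] -/
theorem eq_one_of_vecAct_eq' {Φ : BinQF} (hΦ : ¬ IsSquare Φ.disc) {σ : SL(2, ℤ)}
    (hσ : σ ∈ stab Φ) {v : ℤ × ℤ} (hv : IsCoprime v.1 v.2) (h : vecAct σ v = v) : σ = 1 :=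
  RootForms.eq_one_of_vecAct_eq hΦ hσ (Int.isCoprime_iff_gcd_eq_one.mp hv) h

/-! ### Positive class representatives -/

/-- `PosForm Δ f`: `f` has discriminant `Δ` and positive leading coefficient. [folklore] -/
def PosForm (Δ : ℤ) (f : BinQF) : Prop := f.disc = Δ ∧ 0 < f.a

/-- The representative of the class of `f` among forms with positive leading coefficient, chosen
by `Classical.epsilon` (depends only on the class, `repOf_eq_of_properEquiv`). [folklore] -/
def repOf (Δ : ℤ) (f : BinQF) : BinQF :=
  Classical.epsilon (fun g => PosForm Δ g ∧ f.ProperEquiv g)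

/-- `repOf` is a class invariant. [folklore] -/
theorem repOf_eq_of_properEquiv (Δ : ℤ) {f₁ f₂ : BinQF} (h : f₁.ProperEquiv f₂) :
    repOf Δ f₁ = repOf Δ f₂ := by
  have hP : (fun g => PosForm Δ g ∧ f₁.ProperEquiv g) = (fun g => PosForm Δ g ∧ f₂.ProperEquiv g) :=
    funext fun g => propext ⟨fun ⟨hg, h1⟩ => ⟨hg, h.symm.trans h1⟩, fun ⟨hg, h2⟩ => ⟨hg, h.trans h2⟩⟩
  unfold repOf
  rw [hP]

/-- If the class of `f` contains a form with positive leading coefficient, `repOf Δ f` is such a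
form, properly equivalent to `f`. [folklore] -/
theorem repOf_spec {Δ : ℤ} {f : BinQF} (hex : ∃ g, PosForm Δ g ∧ f.ProperEquiv g) :
    PosForm Δ (repOf Δ f) ∧ f.ProperEquiv (repOf Δ f) :=
  Classical.epsilon_spec (p := fun g => PosForm Δ g ∧ f.ProperEquiv g) hex

open scoped Classical in
/-- **Positive class representatives**: one form with positive leading coefficient in every
class of discriminant `Δ` that contains one — the `repOf` of the members of the tree's finite
set `RootForms.classReps Δ` (which meets every class). [folklore] -/
def posReps (Δ : ℤ) : Finset BinQF :=
  ((RootForms.classReps Δ).filter (fun g => ∃ g', PosForm Δ g' ∧ g.ProperEquiv g')).image (repOf Δ)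

/-- Members of `posReps Δ` have discriminant `Δ` and positive leading coefficient. [folklore] -/
theorem posForm_of_mem_posReps {Δ : ℤ} {g : BinQF} (hg : g ∈ posReps Δ) : PosForm Δ g := by
  classical
  rw [posReps, Finset.mem_image] at hg
  obtain ⟨g₀, hg₀, rfl⟩ := hg
  rw [Finset.mem_filter] at hg₀
  exact (repOf_spec hg₀.2).1

/-- Distinct members of `posReps Δ` are properly inequivalent. [folklore] -/
theorem eq_of_mem_posReps_of_properEquiv {Δ : ℤ} {g₁ g₂ : BinQF} (h₁ : g₁ ∈ posReps Δ)
    (h₂ : g₂ ∈ posReps Δ) (h : g₁.ProperEquiv g₂) : g₁ = g₂ := by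
  classical
  rw [posReps, Finset.mem_image] at h₁ h₂
  obtain ⟨f₁, hf₁, rfl⟩ := h₁
  obtain ⟨f₂, hf₂, rfl⟩ := h₂
  rw [Finset.mem_filter] at hf₁ hf₂
  have e₁ := (repOf_spec hf₁.2).2
  have e₂ := (repOf_spec hf₂.2).2
  exact repOf_eq_of_properEquiv Δ ((e₁.trans h).trans e₂.symm)

/-- **Completeness.** Every form of non-square discriminant `Δ` with positive leading coefficient
is properly equivalent to a member of `posReps Δ`. [folklore] -/
theorem exists_mem_posReps_properEquiv {Δ : ℤ} (h : ¬ IsSquare Δ) {f : BinQF}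
    (hf : PosForm Δ f) : ∃ g ∈ posReps Δ, f.ProperEquiv g := by
  classical
  have hf' : ¬ IsSquare f.disc := by rw [hf.1]; exact h
  obtain ⟨R, hR, ξ, hfR⟩ := RootForms.exists_mem_classReps hf'
  rw [hf.1] at hR
  have hRf : R.ProperEquiv f := properEquiv_iff_exists_smul.mpr ⟨ξ, hfR⟩
  have hex : ∃ g', PosForm Δ g' ∧ R.ProperEquiv g' := ⟨f, hf, hRf⟩
  refine ⟨repOf Δ R, ?_, hRf.symm.trans (repOf_spec hex).2⟩
  rw [posReps, Finset.mem_image]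
  exact ⟨R, Finset.mem_filter.mpr ⟨hR, hex⟩, rfl⟩

/-- Every form of non-square discriminant `Δ` with positive leading coefficient is properly
equivalent to EXACTLY ONE member of `posReps Δ`. [folklore] -/
theorem existsUnique_mem_posReps_properEquiv {Δ : ℤ} (h : ¬ IsSquare Δ) {f : BinQF}
    (hf : PosForm Δ f) : ∃! g, g ∈ posReps Δ ∧ f.ProperEquiv g := by
  obtain ⟨g, hg, hfg⟩ := exists_mem_posReps_properEquiv h hf
  exact ⟨g, ⟨hg, hfg⟩, fun g' ⟨hg', hfg'⟩ => eq_of_mem_posReps_of_properEquiv hg' hg (hfg'.symm.trans hfg)⟩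

/-- `posReps Δ` is nonempty as soon as some form of non-square discriminant `Δ` has positive
leading coefficient, e.g. for `Δ = b² − 4ac` with `a > 0`. [folklore] -/
theorem posReps_nonempty {Δ : ℤ} (h : ¬ IsSquare Δ) {f : BinQF} (hf : PosForm Δ f) :
    (posReps Δ).Nonempty := by
  obtain ⟨g, hg, -⟩ := exists_mem_posReps_properEquiv h hf
  exact ⟨g, hg⟩

/-! ### Bezout completion of a coprime vector and the middle coefficient `ℓ` -/

/-- The Bezout completion `γ_v = (u, −β; s, α)` of a coprime column `(u, s)`, where
`u α + s β = 1` are Mathlib's `gcdA/gcdB` coefficients (and the identity for a non-coprime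
pair, a junk value never used). [folklore] -/
def complSL (v : ℤ × ℤ) : SL(2, ℤ) :=
  if h : Int.gcd v.1 v.2 = 1 then
    ⟨!![v.1, -(Int.gcdB v.1 v.2); v.2, Int.gcdA v.1 v.2], by
      rw [Matrix.det_fin_two_of]
      have := Int.gcd_eq_gcd_ab v.1 v.2
      rw [h] at this
      push_cast at this
      linear_combination -this⟩
  else 1

/-- The entries of the Bezout completion. [folklore] -/
theorem complSL_apply {v : ℤ × ℤ} (hv : IsCoprime v.1 v.2) :
    (complSL v) 0 0 = v.1 ∧ (complSL v) 1 0 = v.2 ∧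
      (complSL v) 0 1 = -(Int.gcdB v.1 v.2) ∧ (complSL v) 1 1 = Int.gcdA v.1 v.2 := by
  have h : Int.gcd v.1 v.2 = 1 := Int.isCoprime_iff_gcd_eq_one.mp hv
  simp [complSL, h]

/-- The first column of the Bezout completion of `v` is `v`. [folklore] -/
theorem vecAct_complSL_e1 {v : ℤ × ℤ} (hv : IsCoprime v.1 v.2) : vecAct (complSL v) (1, 0) = v := by
  obtain ⟨h1, h2, -, -⟩ := complSL_apply hv
  rw [vecAct_e1, h1, h2]

/-- `ℓ = ellOf Φ u s`, the middle coefficient of `Φ·γ_v` for the Bezout completion `γ_v` of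
`v = (u, s)`: `ℓ = 2A u u' + B(u s' + u' s) + 2C s s'` with `(u', s') = (−gcdB, gcdA)`.
(Defined for every pair; meaningful for coprime ones.) [cite: Cox2013, §2.A (Lemma 2.5)] -/
def ellOf (Φ : BinQF) (u s : ℤ) : ℤ :=
  (Φ.act u (-(Int.gcdB u s)) s (Int.gcdA u s)).b

/-- `Φ·γ_v = (Φ(v), ℓ, ∗)`. [folklore] -/
theorem smul_complSL {Φ : BinQF} {v : ℤ × ℤ} (hv : IsCoprime v.1 v.2) :
    (smul Φ (complSL v)).a = Φ.eval v.1 v.2 ∧ (smul Φ (complSL v)).b = ellOf Φ v.1 v.2 := by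
  obtain ⟨h1, h2, h3, h4⟩ := complSL_apply hv
  refine ⟨?_, ?_⟩
  · rw [smul_a, h1, h2]
  · rw [smul, h1, h2, h3, h4, ellOf]

/-- **Transport lemma.** For `γ₁ = (u₁ q₁; s₁ t₁) ∈ SL₂(ℤ)` and any integer matrix
`γ₂ = (u₂ q₂; s₂ t₂)` with `det γ₂ ≡ 1`, `u₂ ≡ u₁`, `s₂ ≡ s₁ (mod M)` and `M ∣ 2Φ(u₁, s₁)`, the
middle coefficients of `Φ·γ₁` and `Φ·γ₂` agree modulo `M`: modulo `M` the second column of `γ₂`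
is that of `γ₁ T^t` for some `t`, and `(Φ·γ₁T^t).b = (Φ·γ₁).b + 2tΦ(u₁, s₁)`.
[cite: Cox2013, §2.A (proof of Lemma 2.5)] -/
theorem act_b_modEq_of_modEq (Φ : BinQF) {u₁ q₁ s₁ t₁ u₂ q₂ s₂ t₂ : ℤ} {M : ℕ}
    (h₁ : u₁ * t₁ - q₁ * s₁ = 1) (h₂ : u₂ * t₂ - q₂ * s₂ ≡ 1 [ZMOD M])
    (hu : u₂ ≡ u₁ [ZMOD M]) (hs : s₂ ≡ s₁ [ZMOD M]) (hM : (M : ℤ) ∣ 2 * Φ.eval u₁ s₁) :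
    (Φ.act u₂ q₂ s₂ t₂).b ≡ (Φ.act u₁ q₁ s₁ t₁).b [ZMOD M] := by
  rw [← ZMod.intCast_eq_intCast_iff] at h₂ hu hs ⊢
  have hM' : ((2 * Φ.eval u₁ s₁ : ℤ) : ZMod M) = 0 := by
    rw [ZMod.intCast_zmod_eq_zero_iff_dvd]; exact hM
  simp only [BinQF.act, BinQF.eval] at hM' ⊢
  push_cast at h₂ hu hs hM' ⊢
  have h₁' : (u₁ : ZMod M) * t₁ - q₁ * s₁ = 1 := by exact_mod_cast congrArg (Int.cast : ℤ → ZMod M) h₁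
  -- the shear parameter
  set t : ZMod M := ((q₂ : ZMod M) - q₁) * t₁ - ((t₂ : ZMod M) - t₁) * q₁ with ht
  have hX : ((q₂ : ZMod M) - q₁) * s₁ - ((t₂ : ZMod M) - t₁) * u₁ = 0 := by
    linear_combination h₁' - h₂ + (t₂ : ZMod M) * hu - (q₂ : ZMod M) * hs
  have hq : (q₂ : ZMod M) = q₁ + t * u₁ := by
    rw [ht]
    linear_combination (-(q₁ : ZMod M)) * hX - ((q₂ : ZMod M) - q₁) * h₁'
  have htt : (t₂ : ZMod M) = t₁ + t * s₁ := by
    rw [ht]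
    linear_combination (-(t₁ : ZMod M)) * hX - ((t₂ : ZMod M) - t₁) * h₁'
  rw [hu, hs, hq, htt]
  linear_combination t * hM'

/-- The middle coefficient of `Φ·γ` modulo `2Φ(v)` depends only on the first column `v` of `γ`:
it is `ellOf Φ v` modulo `2Φ(v)`. [cite: Cox2013, §2.A (Lemma 2.5)] -/
theorem smul_b_modEq_ellOf (Φ : BinQF) (γ : SL(2, ℤ)) :
    (smul Φ γ).b ≡ ellOf Φ (γ 0 0) (γ 1 0) [ZMOD (2 * Φ.eval (γ 0 0) (γ 1 0)).natAbs] := by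
  have hcop := isCoprime_col γ
  obtain ⟨h1, h2, h3, h4⟩ := complSL_apply (v := (γ 0 0, γ 1 0)) hcop
  have hdet₁ := det_SL_two (complSL (γ 0 0, γ 1 0))
  rw [h1, h2, h3, h4] at hdet₁
  rw [smul, ellOf]
  refine act_b_modEq_of_modEq Φ hdet₁ ?_ (Int.ModEq.refl _) (Int.ModEq.refl _) ?_
  · rw [det_SL_two γ]
  · simp only [Int.natCast_natAbs]
    exact (abs_dvd_self _)

/-! ### The form `Ψ_Θ` attached to a root, admissible representations, and `Θ_Φ(v)` -/

variable {a b c : ℤ}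

/-- `G(Θ) = aΘ² + bΘ + c` (an abbreviation local to this file's statements). [folklore] -/
abbrev quadVal (a b c Θ : ℤ) : ℤ := a * Θ ^ 2 + b * Θ + c

/-- `Ψ_Θ = (aD, 2aΘ + b, G(Θ)/D)`, the form of discriminant `Δ` attached to a root `Θ` of `G`
modulo `D` (Gauss's form `(n, ℓ, (ℓ² − Δ)/4n)` with `n = aD`, `ℓ = 2aΘ + b`).
[cite: IwaniecInventiones1978, Lemma 5] -/
def thetaForm (a b c : ℤ) (D : ℕ) (Θ : ℤ) : BinQF :=
  ⟨a * D, 2 * a * Θ + b, quadVal a b c Θ / D⟩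

/-- `disc Ψ_Θ = b² − 4ac` when `D ∣ G(Θ)`. [folklore] -/
theorem disc_thetaForm {D : ℕ} {Θ : ℤ} (hD : (D : ℤ) ∣ quadVal a b c Θ) :
    (thetaForm a b c D Θ).disc = discrim a b c := by
  obtain ⟨k, hk⟩ := hD
  rw [thetaForm, BinQF.disc, discrim]
  by_cases hD0 : (D : ℤ) = 0
  · rw [hD0, zero_mul] at hk
    simp only [hD0, mul_zero, EuclideanDomain.div_zero]
    rw [quadVal] at hk
    linear_combination 4 * a * hk
  · rw [hk, Int.mul_ediv_cancel_left _ hD0]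
    rw [quadVal] at hk
    linear_combination 4 * a * hk

/-- `Ψ_{Θ + Dt} = Ψ_Θ · T^t`. [folklore] -/
theorem thetaForm_add_mul {D : ℕ} (hD0 : (D : ℤ) ≠ 0) {Θ : ℤ} (hD : (D : ℤ) ∣ quadVal a b c Θ)
    (t : ℤ) : thetaForm a b c D (Θ + D * t) = (thetaForm a b c D Θ).act 1 t 0 1 := by
  obtain ⟨k, hk⟩ := hD
  rw [act_T, thetaForm, thetaForm]
  have hk' : quadVal a b c (Θ + D * t) = D * (k + t * (2 * a * Θ + b) + a * D * t ^ 2) := by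
    rw [quadVal] at hk ⊢
    linear_combination hk
  ext
  · rfl
  · simp only; ring
  · simp only
    rw [hk', hk, Int.mul_ediv_cancel_left _ hD0, Int.mul_ediv_cancel_left _ hD0]
    ring

/-- `Θ_Φ(v) = (ℓ − b)/(2a)`, the integer attached to a pair `v = (u, s)` (a root of `G` modulo
`D` when `v` is an admissible representation of `aD`, `dvd_quad_thetaOf`).
[cite: IwaniecInventiones1978, Lemma 5] -/
def thetaOf (a b : ℤ) (Φ : BinQF) (v : ℤ × ℤ) : ℤ := (ellOf Φ v.1 v.2 - b) / (2 * a)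

/-- `v = (u, s)` is an *admissible representation* of `n` by `Φ` (relative to `G`): coprime,
`Φ(u, s) = n`, and `ℓ ≡ b (mod 2a)`. [cite: IwaniecInventiones1978, Lemma 5] -/
structure IsAdmRep (a b : ℤ) (Φ : BinQF) (n : ℤ) (v : ℤ × ℤ) : Prop where
  coprime : IsCoprime v.1 v.2
  eval_eq : Φ.eval v.1 v.2 = n
  modEq : ellOf Φ v.1 v.2 ≡ b [ZMOD 2 * a]

/-- For an admissible `v`, `2a Θ_Φ(v) + b = ℓ`. [folklore] -/
theorem two_mul_a_mul_thetaOf {Φ : BinQF} {n : ℤ} {v : ℤ × ℤ} (hv : IsAdmRep a b Φ n v) :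
    2 * a * thetaOf a b Φ v + b = ellOf Φ v.1 v.2 := by
  rw [thetaOf, Int.mul_ediv_cancel' (Int.ModEq.dvd hv.modEq.symm)]
  ring

/-- **`Φ·γ_v = Ψ_{Θ_Φ(v)}`** for an admissible representation `v` of `aD` by a form `Φ` of
discriminant `b² − 4ac` (`a ≠ 0`): the completed form is `(aD, ℓ, (ℓ² − Δ)/(4aD))` and
`ℓ = 2aΘ + b`, `(ℓ² − Δ)/(4a) = G(Θ)`. [cite: IwaniecInventiones1978, Lemma 5] -/
theorem smul_complSL_eq_thetaForm (ha : a ≠ 0) {Φ : BinQF} (hΦ : Φ.disc = discrim a b c)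
    {D : ℕ} (hD0 : D ≠ 0) {v : ℤ × ℤ} (hv : IsAdmRep a b Φ (a * D) v) :
    smul Φ (complSL v) = thetaForm a b c D (thetaOf a b Φ v) := by
  obtain ⟨hA, hB⟩ := smul_complSL (Φ := Φ) hv.coprime
  rw [hv.eval_eq] at hA
  have hdisc : (smul Φ (complSL v)).disc = discrim a b c := by rw [smul_disc, hΦ]
  set Ψ := smul Φ (complSL v) with hΨ
  set Θ := thetaOf a b Φ v with hΘ
  have hℓ : 2 * a * Θ + b = Ψ.b := by rw [hB]; exact two_mul_a_mul_thetaOf hv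
  -- `ℓ² − 4 (aD) Ψ.c = Δ` gives `G(Θ) = D Ψ.c`
  have hG : quadVal a b c Θ = D * Ψ.c := by
    rw [BinQF.disc, hA, ← hℓ, discrim] at hdisc
    have h4a : (4 * a : ℤ) ≠ 0 := by positivity
    apply mul_left_cancel₀ h4a
    rw [quadVal]
    linear_combination hdisc
  have hD0' : (D : ℤ) ≠ 0 := by exact_mod_cast hD0
  ext
  · rw [hA]; rfl
  · rw [← hℓ]; rfl
  · show Ψ.c = quadVal a b c Θ / D
    rw [hG, Int.mul_ediv_cancel_left _ hD0']

/-- **An admissible representation of `aD` gives a root of `G` modulo `D`.**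
[cite: IwaniecInventiones1978, Lemma 5] -/
theorem dvd_quad_thetaOf (ha : a ≠ 0) {Φ : BinQF} (hΦ : Φ.disc = discrim a b c) {D : ℕ}
    (hD0 : D ≠ 0) {v : ℤ × ℤ} (hv : IsAdmRep a b Φ (a * D) v) :
    (D : ℤ) ∣ quadVal a b c (thetaOf a b Φ v) := by
  have h := smul_complSL_eq_thetaForm ha hΦ hD0 hv
  obtain ⟨hA, hB⟩ := smul_complSL (Φ := Φ) hv.coprime
  have hdisc : (smul Φ (complSL v)).disc = discrim a b c := by rw [smul_disc, hΦ]
  rw [h, thetaForm, BinQF.disc, discrim] at hdisc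
  set Θ := thetaOf a b Φ v
  -- `(2aΘ+b)² − 4aD (G(Θ)/D) = b² − 4ac` forces `D ∣ G(Θ)` (compare with `disc_eq`)
  have key : 4 * a * ((D : ℤ) * (quadVal a b c Θ / D)) = 4 * a * quadVal a b c Θ := by
    rw [quadVal]; linear_combination -hdisc
  have h4a : (4 * a : ℤ) ≠ 0 := by positivity
  have := mul_left_cancel₀ h4a key
  exact ⟨_, this.symm⟩

/-- The form `Φ` of an admissible representation of `aD` is properly equivalent to `Ψ_{Θ_Φ(v)}`.
[cite: IwaniecInventiones1978, Lemma 5] -/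
theorem properEquiv_thetaForm_thetaOf (ha : a ≠ 0) {Φ : BinQF} (hΦ : Φ.disc = discrim a b c)
    {D : ℕ} (hD0 : D ≠ 0) {v : ℤ × ℤ} (hv : IsAdmRep a b Φ (a * D) v) :
    Φ.ProperEquiv (thetaForm a b c D (thetaOf a b Φ v)) :=
  properEquiv_iff_exists_smul.mpr ⟨complSL v, (smul_complSL_eq_thetaForm ha hΦ hD0 hv).symm⟩

/-! ### Every root arises; the class is determined by the root -/

/-- `Ψ_Θ` has discriminant `Δ` and positive leading coefficient `aD`. [folklore] -/
theorem posForm_thetaForm (ha : 0 < a) {D : ℕ} (hD : 0 < D) {Θ : ℤ}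
    (hΘ : (D : ℤ) ∣ quadVal a b c Θ) : PosForm (discrim a b c) (thetaForm a b c D Θ) :=
  ⟨disc_thetaForm hΘ, mul_pos ha (by exact_mod_cast hD)⟩

/-- **From `Φ·γ = Ψ_Θ` to an admissible representation.** If `Φ·γ = Ψ_Θ` then the first column
`v` of `γ` is an admissible representation of `aD` by `Φ` with `Θ_Φ(v) ≡ Θ (mod D)`.
[cite: IwaniecInventiones1978, Lemma 5] -/
theorem isAdmRep_of_smul_eq_thetaForm (ha : a ≠ 0) {Φ : BinQF} {D : ℕ} {Θ : ℤ}
    {γ : SL(2, ℤ)} (hγ : smul Φ γ = thetaForm a b c D Θ) :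
    IsAdmRep a b Φ (a * D) (γ 0 0, γ 1 0) ∧ thetaOf a b Φ (γ 0 0, γ 1 0) ≡ Θ [ZMOD D] := by
  have hA : Φ.eval (γ 0 0) (γ 1 0) = a * D := by rw [← smul_a, hγ]; rfl
  have hmod := smul_b_modEq_ellOf Φ γ
  rw [hγ, hA] at hmod
  have hb : (thetaForm a b c D Θ).b = 2 * a * Θ + b := rfl
  rw [hb] at hmod
  -- `ℓ = 2aΘ + b + 2aD t`
  have hdvd : (2 * a * D : ℤ) ∣ ellOf Φ (γ 0 0) (γ 1 0) - (2 * a * Θ + b) := by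
    refine (Int.dvd_natAbs.mpr ?_ : (2 * a * D : ℤ) ∣ ((2 * (a * (D : ℤ))).natAbs : ℤ)).trans
      (Int.ModEq.dvd hmod)
    exact ⟨1, by ring⟩
  obtain ⟨t, ht⟩ := hdvd
  have hℓ : ellOf Φ (γ 0 0) (γ 1 0) = 2 * a * (Θ + D * t) + b := by linear_combination ht
  have hadm : IsAdmRep a b Φ (a * D) (γ 0 0, γ 1 0) :=
    ⟨isCoprime_col γ, hA, Int.modEq_iff_dvd.mpr ⟨-(Θ + D * t), by simp only; rw [hℓ]; ring⟩⟩
  refine ⟨hadm, ?_⟩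
  have h2 := two_mul_a_mul_thetaOf hadm
  simp only at h2
  rw [hℓ] at h2
  have h2a : (2 * a : ℤ) ≠ 0 := by positivity
  have : thetaOf a b Φ (γ 0 0, γ 1 0) = Θ + D * t := by
    apply mul_left_cancel₀ h2a; linear_combination h2
  rw [this]
  exact Int.modEq_iff_dvd.mpr ⟨-t, by ring⟩

/-- **Every root of `G` modulo `D` arises** from an admissible representation of `aD` by a class
representative (`a > 0`, `D ≥ 1`, `Δ` not a square). [cite: IwaniecInventiones1978, Lemma 5] -/
theorem exists_isAdmRep_of_dvd (ha : 0 < a) (hΔ : ¬ IsSquare (discrim a b c)) {D : ℕ}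
    (hD : 0 < D) {Θ : ℤ} (hΘ : (D : ℤ) ∣ quadVal a b c Θ) :
    ∃ Φ ∈ posReps (discrim a b c), ∃ v : ℤ × ℤ,
      IsAdmRep a b Φ (a * D) v ∧ thetaOf a b Φ v ≡ Θ [ZMOD D] := by
  obtain ⟨Φ, hΦ, hΨΦ⟩ := exists_mem_posReps_properEquiv hΔ (posForm_thetaForm ha hD hΘ)
  obtain ⟨γ, hγ⟩ := properEquiv_iff_exists_smul.mp hΨΦ.symm
  obtain ⟨hadm, hmod⟩ := isAdmRep_of_smul_eq_thetaForm ha.ne' hγ.symm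
  exact ⟨Φ, hΦ, _, hadm, hmod⟩

/-- Admissible representations of `aD` by two class representatives with congruent roots force
the representatives to coincide (the class of `Ψ_Θ` depends only on `Θ mod D`).
[cite: IwaniecInventiones1978, Lemma 5] -/
theorem eq_of_thetaOf_modEq (ha : a ≠ 0) {D : ℕ} (hD0 : D ≠ 0) {Φ₁ Φ₂ : BinQF}
    (h₁ : Φ₁ ∈ posReps (discrim a b c)) (h₂ : Φ₂ ∈ posReps (discrim a b c))
    {v₁ v₂ : ℤ × ℤ} (hv₁ : IsAdmRep a b Φ₁ (a * D) v₁) (hv₂ : IsAdmRep a b Φ₂ (a * D) v₂)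
    (h : thetaOf a b Φ₁ v₁ ≡ thetaOf a b Φ₂ v₂ [ZMOD D]) : Φ₁ = Φ₂ := by
  have hd₁ : Φ₁.disc = discrim a b c := (posForm_of_mem_posReps h₁).1
  have hd₂ : Φ₂.disc = discrim a b c := (posForm_of_mem_posReps h₂).1
  have e₁ := properEquiv_thetaForm_thetaOf ha hd₁ hD0 hv₁
  have e₂ := properEquiv_thetaForm_thetaOf ha hd₂ hD0 hv₂
  obtain ⟨t, ht⟩ := Int.modEq_iff_dvd.mp h
  have hroot₁ : (D : ℤ) ∣ quadVal a b c (thetaOf a b Φ₁ v₁) := dvd_quad_thetaOf ha hd₁ hD0 hv₁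
  have hD0' : (D : ℤ) ≠ 0 := by exact_mod_cast hD0
  have e₃ : (thetaForm a b c D (thetaOf a b Φ₁ v₁)).ProperEquiv
      (thetaForm a b c D (thetaOf a b Φ₂ v₂)) := by
    have : thetaOf a b Φ₂ v₂ = thetaOf a b Φ₁ v₁ + D * t := by linear_combination ht
    rw [this, thetaForm_add_mul hD0' hroot₁ t]
    exact ⟨1, t, 0, 1, by norm_num, rfl⟩
  exact eq_of_mem_posReps_of_properEquiv h₁ h₂ ((e₁.trans e₃).trans e₂.symm)

/-! ### Fibres are orbits of proper automorphs -/

/-- `Ψ·T^t` in `SL₂(ℤ)` language. [folklore] -/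
theorem smul_T_zpow_eq_act (f : BinQF) (t : ℤ) : smul f (ModularGroup.T ^ t) = f.act 1 t 0 1 := by
  simp only [smul, ModularGroup.coe_T_zpow, Matrix.of_apply, Matrix.cons_val',
    Matrix.cons_val_zero, Matrix.cons_val_one, Matrix.cons_val_fin_one]

/-- `T^t · e₁ = e₁`. [folklore] -/
theorem vecAct_T_zpow_e1 (t : ℤ) : vecAct (ModularGroup.T ^ t) (1, 0) = (1, 0) := by
  rw [vecAct_e1]
  simp [ModularGroup.coe_T_zpow]

/-- **Two admissible representations of `aD` by `Φ` with congruent roots differ by a proper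
automorph of `Φ`.** [cite: IwaniecInventiones1978, Lemma 5] -/
theorem exists_mem_stab_of_thetaOf_modEq (ha : a ≠ 0) {Φ : BinQF}
    (hΦ : Φ.disc = discrim a b c) {D : ℕ} (hD0 : D ≠ 0) {v₁ v₂ : ℤ × ℤ}
    (hv₁ : IsAdmRep a b Φ (a * D) v₁) (hv₂ : IsAdmRep a b Φ (a * D) v₂)
    (h : thetaOf a b Φ v₁ ≡ thetaOf a b Φ v₂ [ZMOD D]) :
    ∃ σ ∈ stab Φ, vecAct σ v₁ = v₂ := by
  have e₁ := smul_complSL_eq_thetaForm ha hΦ hD0 hv₁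
  have e₂ := smul_complSL_eq_thetaForm ha hΦ hD0 hv₂
  obtain ⟨t, ht⟩ := Int.modEq_iff_dvd.mp h
  have hroot₁ : (D : ℤ) ∣ quadVal a b c (thetaOf a b Φ v₁) := dvd_quad_thetaOf ha hΦ hD0 hv₁
  have hD0' : (D : ℤ) ≠ 0 := by exact_mod_cast hD0
  have e₃ : smul Φ (complSL v₂) = smul Φ (complSL v₁ * ModularGroup.T ^ t) := by
    rw [smul_mul, e₁, e₂, smul_T_zpow_eq_act, ← thetaForm_add_mul hD0' hroot₁ t]
    congr 1
    linear_combination ht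
  refine ⟨complSL v₂ * (complSL v₁ * ModularGroup.T ^ t)⁻¹, ?_, ?_⟩
  · rw [mem_stab_iff, smul_mul, e₃, smul_mul_inv]
  · have hX : vecAct (complSL v₁ * ModularGroup.T ^ t) (1, 0) = v₁ := by
      rw [vecAct_mul, vecAct_T_zpow_e1, vecAct_complSL_e1 hv₁.coprime]
    calc vecAct (complSL v₂ * (complSL v₁ * ModularGroup.T ^ t)⁻¹) v₁
        = vecAct (complSL v₂ * (complSL v₁ * ModularGroup.T ^ t)⁻¹)
            (vecAct (complSL v₁ * ModularGroup.T ^ t) (1, 0)) := by rw [hX]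
      _ = vecAct (complSL v₂ * (complSL v₁ * ModularGroup.T ^ t)⁻¹ *
            (complSL v₁ * ModularGroup.T ^ t)) (1, 0) := by rw [← vecAct_mul]
      _ = v₂ := by rw [inv_mul_cancel_right, vecAct_complSL_e1 hv₂.coprime]

/-- **Proper automorphs permute the admissible representations of `aD` within a fibre**:
`σ·v` is again admissible and has the same root modulo `D`. [cite: IwaniecInventiones1978, Lemma 5] -/
theorem isAdmRep_vecAct (ha : a ≠ 0) {Φ : BinQF} {D : ℕ} (hD0 : D ≠ 0) {σ : SL(2, ℤ)}
    (hσ : σ ∈ stab Φ) {v : ℤ × ℤ} (hv : IsAdmRep a b Φ (a * D) v) (hΦ : Φ.disc = discrim a b c) :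
    IsAdmRep a b Φ (a * D) (vecAct σ v) ∧ thetaOf a b Φ (vecAct σ v) ≡ thetaOf a b Φ v [ZMOD D] := by
  set γ' := σ * complSL v with hγ'
  have hcol : (γ' 0 0, γ' 1 0) = vecAct σ v := by
    rw [← vecAct_e1, hγ', vecAct_mul, vecAct_complSL_e1 hv.coprime]
  have hform : smul Φ γ' = thetaForm a b c D (thetaOf a b Φ v) := by
    rw [hγ', smul_mul, mem_stab_iff.mp hσ, smul_complSL_eq_thetaForm ha hΦ hD0 hv]
  have := isAdmRep_of_smul_eq_thetaForm (b := b) (c := c) ha hform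
  rwa [hcol] at this

end Literature.NumberTheory.Sieve.Iwaniec1978

end
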